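import Mathlib.Analysis.SpecialFunctions.Pow.Real
import Mathlib.Analysis.SpecialFunctions.Log.Basic
import Mathlib.Analysis.SpecialFunctions.Sqrt
import Mathlib.Topology.Algebra.InfiniteSum.Real
import Mathlib.Topology.Order.MonotoneConvergence
import HarnessLib

/-!
# The decay rate of a positive spectral sum is the top of its spectral support; effective masses converge to it

Topic `Literature/Analysis/OperatorTheory`.  Theorem-only; Mathlib only; no definitions, no named facts.

SETTING.  A **positive spectral sum** is a sequence `S : ℕ → ℝ` with
`S M = Σᵢ λᵢ^M qᵢ` (`HasSum`, any index type), `0 ≤ λᵢ ≤ L`, `0 ≤ qᵢ` — the shape of every diagonal Euclidean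
correlator of a positive transfer operator expanded in an eigenbasis (`C(t) = Σᵢ |cᵢ|² e^{−m̂ᵢ t}`, `λᵢ = e^{−m̂ᵢ}`),
of the trace of powers `Tr 𝕋^{M+2} = Σᵢ λᵢ^{M+2}`, and of 't Hooft's flux-projected traces
`Tr P(e) 𝕋^{M+2} = Σᵢ λᵢ^M qᵢ(e)` (`Literature/Analysis/OperatorTheory/TwistedKernelFluxSectors.lean`).  Its
**spectral top** is `Λ := ⨆ {λᵢ : qᵢ ≠ 0}` (written out as `⨆ i : {i // q i ≠ 0}, lam i`; `= 0` for an empty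
support), i.e. `e^{−E}` with `E` the energy of the lowest state CARRYING WEIGHT in the channel.

AS PRINTED.  C. Michael, *Hadronic physics from the lattice* (1997) §2 (2)–(3): for
`C(t) = Σᵢ |cᵢ|² e^{−m̂ᵢ t}`, "As `t → ∞`, the lightest glueball mass will dominate. This can be expressed as
`m̂₀ = lim_{t→∞} m̂_eff(t)` where `m̂_eff(t) = log(C(t−1)/C(t))` … `m̂_eff(t) > m̂_eff(t+1) > m̂₀`" (corpus
`paper:arxiv-hep-ph_9710249` p.6); I. Montvay, G. Münster, *Quantum Fields on a Lattice* (1994) §7.1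
(7.29)–(7.31) ("the true mass is given by `m = lim m(t₁,t₂,T)`"); G. 't Hooft, Nucl. Phys. B 153 (1979) 141, §5
after (5.4): "In the limit `β → ∞` (or `T → 0`), `F` becomes the energy of the lowest state with the given flux
configuration" (reprint C. Rebbi (ed.) 1983, p. 553).  The tree file
`Literature/MathematicalPhysics/QuantumFieldTheory/TransferEffectiveMass.lean` proves the MONOTONICITY half
("effective masses are upper bounds") over `TransferData`; the present file proves the CONVERGENCE half, and the
root-test ∕ free-energy-per-unit-time forms, for spectral sums.

PROVED (hypotheses: `0 ≤ λᵢ ≤ L`, `0 ≤ qᵢ`, `∀ M, HasSum (fun i => lam i ^ M * q i) (S M)`):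

* `spectralSum_nonneg`, `mul_le_spectralSum` (each term is below the sum), `le_spectralTop` ∕ `spectralTop_nonneg` ∕
  `spectralTop_le`;
* `spectralSum_succ_le` — **sharp one-step decay** `S (M+1) ≤ Λ · S M`; `spectralSum_add_le` (`S (M+k) ≤ Λ^k S M`),
  `spectralSum_le_spectralTop_pow_mul` (`S M ≤ Λ^M S 0`);
* `exists_of_spectralSum_one_pos` ∕ `spectralSum_pos` — `0 < S 1` iff some `qⱼ ≠ 0` has `λⱼ > 0`
  (a NON-DEGENERATE channel), and then every `S M > 0` and `Λ > 0`;
* ★ `tendsto_log_spectralSum_div` — **free energy per unit time**: `log (S M) / M → log Λ`;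
  ★ `tendsto_spectralSum_rpow_inv` — root test: `(S M)^{1/M} → Λ`;
* `spectralSum_succ_sq_le` — **log-convexity** `S (M+1)² ≤ S M · S (M+2)` (Cauchy–Schwarz on the partial sums);
  `spectralSum_ratio_le_succ` (the ratios `S (M+1)/S M` increase), `neg_log_spectralTop_le_effectiveEnergy` and
  `effectiveEnergy_succ_le` (the effective energies `log(S M / S (M+1))` decrease and stay `≥ −log Λ`);
* ★ `tendsto_spectralSum_ratio` (`S (M+1)/S M → Λ`) and ★ `tendsto_effectiveEnergy`
  (`log (S M / S (M+1)) → −log Λ`) — Michael's "`m̂₀ = lim_{t→∞} m̂_eff(t)`", with `m̂₀ = −log Λ` the energy of the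
  lightest state present in the channel.

HONEST FRAMING: elementary real analysis of positive combinations of exponentials; nothing about any model.  In the
applications `Λ` is a ONE-BOX quantity (a finite-volume energy level), not a mass gap.
-/

noncomputable section

namespace Literature.Analysis.OperatorTheory

open Filter Topology Set Finset
open scoped BigOperators

section SpectralSum

variable {ι : Type*} {lam q : ι → ℝ} {S : ℕ → ℝ} {L : ℝ}

/-! ### Order bookkeeping -/

/-- A positive spectral sum is non-negative. [cite: Michael1997, §2 eqs. (2)–(3)] -/
theorem spectralSum_nonneg (hlam : ∀ i, 0 ≤ lam i) (hq : ∀ i, 0 ≤ q i)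
    (hS : ∀ M, HasSum (fun i => lam i ^ M * q i) (S M)) (M : ℕ) : 0 ≤ S M :=
  (hS M).nonneg fun i => mul_nonneg (pow_nonneg (hlam i) M) (hq i)

/-- Each term is below the sum: `λⱼ^M qⱼ ≤ S M`. [cite: Michael1997, §2 eqs. (2)–(3)] -/
theorem mul_le_spectralSum (hlam : ∀ i, 0 ≤ lam i) (hq : ∀ i, 0 ≤ q i)
    (hS : ∀ M, HasSum (fun i => lam i ^ M * q i) (S M)) (M : ℕ) (j : ι) : lam j ^ M * q j ≤ S M :=
  le_hasSum (hS M) j fun i _ => mul_nonneg (pow_nonneg (hlam i) M) (hq i)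

/-- The spectral top bounds every level carrying weight: `qⱼ ≠ 0 ⇒ λⱼ ≤ Λ` (the `e^{−m̂ᵢ} ≤ e^{−m̂₀}` of the
printed expansion). [cite: Michael1997, §2 eqs. (2)–(3)] -/
theorem le_spectralTop (hL : ∀ i, lam i ≤ L) {j : ι} (hj : q j ≠ 0) :
    lam j ≤ ⨆ i : {i // q i ≠ 0}, lam i :=
  le_ciSup (f := fun i : {i // q i ≠ 0} => lam i) ⟨L, by rintro _ ⟨i, rfl⟩; exact hL i⟩ ⟨j, hj⟩

/-- `0 ≤ Λ`. [cite: Michael1997, §2 eqs. (2)–(3)] -/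
theorem spectralTop_nonneg (hlam : ∀ i, 0 ≤ lam i) : 0 ≤ ⨆ i : {i // q i ≠ 0}, lam i :=
  Real.iSup_nonneg fun i => hlam i

/-- `Λ ≤ Λ'` for every non-negative bound `Λ'` of the levels carrying weight. [cite: Michael1997, §2 eqs. (2)–(3)] -/
theorem spectralTop_le {Λ' : ℝ} (hΛ' : 0 ≤ Λ') (h : ∀ i, q i ≠ 0 → lam i ≤ Λ') :
    (⨆ i : {i // q i ≠ 0}, lam i) ≤ Λ' :=
  Real.iSup_le (fun i => h i i.2) hΛ'

/-! ### Sharp decay -/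

/-- **Sharp one-step decay**: `S (M+1) ≤ Λ · S M`. [cite: Michael1997, §2 eqs. (2)–(3)] -/
theorem spectralSum_succ_le (hlam : ∀ i, 0 ≤ lam i) (hL : ∀ i, lam i ≤ L) (hq : ∀ i, 0 ≤ q i)
    (hS : ∀ M, HasSum (fun i => lam i ^ M * q i) (S M)) (M : ℕ) :
    S (M + 1) ≤ (⨆ i : {i // q i ≠ 0}, lam i) * S M := by
  refine hasSum_le (fun i => ?_) (hS (M + 1)) ((hS M).mul_left _)
  by_cases hi : q i = 0
  · simp [hi]
  · rw [pow_succ, mul_comm (lam i ^ M) (lam i), mul_assoc]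
    exact mul_le_mul_of_nonneg_right (le_spectralTop hL hi) (mul_nonneg (pow_nonneg (hlam i) M) (hq i))

/-- `S (M + k) ≤ Λ^k · S M`. [cite: Michael1997, §2 eqs. (2)–(3)] -/
theorem spectralSum_add_le (hlam : ∀ i, 0 ≤ lam i) (hL : ∀ i, lam i ≤ L) (hq : ∀ i, 0 ≤ q i)
    (hS : ∀ M, HasSum (fun i => lam i ^ M * q i) (S M)) (M k : ℕ) :
    S (M + k) ≤ (⨆ i : {i // q i ≠ 0}, lam i) ^ k * S M := by
  induction k with
  | zero => simp
  | succ k ih =>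
    calc S (M + (k + 1)) = S (M + k + 1) := by rw [add_assoc]
      _ ≤ (⨆ i : {i // q i ≠ 0}, lam i) * S (M + k) := spectralSum_succ_le hlam hL hq hS (M + k)
      _ ≤ (⨆ i : {i // q i ≠ 0}, lam i) * ((⨆ i : {i // q i ≠ 0}, lam i) ^ k * S M) :=
          mul_le_mul_of_nonneg_left ih (spectralTop_nonneg hlam)
      _ = (⨆ i : {i // q i ≠ 0}, lam i) ^ (k + 1) * S M := by ring

/-- `S M ≤ Λ^M · S 0` — in 't Hooft's setting: the flux free energy at inverse temperature `M + 2` is at least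
`M` times the energy of the lowest state of that flux (`e^{−βF} ≤ Λ^M · z(2)`).
[cite: tHooft1979Flux, §5 after (5.4)] [cite: Michael1997, §2 eqs. (2)–(3)] -/
theorem spectralSum_le_spectralTop_pow_mul (hlam : ∀ i, 0 ≤ lam i) (hL : ∀ i, lam i ≤ L) (hq : ∀ i, 0 ≤ q i)
    (hS : ∀ M, HasSum (fun i => lam i ^ M * q i) (S M)) (M : ℕ) :
    S M ≤ (⨆ i : {i // q i ≠ 0}, lam i) ^ M * S 0 := by
  simpa using spectralSum_add_le hlam hL hq hS 0 M

/-! ### Non-degenerate channels -/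

/-- If `S 1 > 0` then some level with weight is non-zero: `∃ j, qⱼ ≠ 0 ∧ 0 < λⱼ` (the channel is
non-degenerate). [cite: Michael1997, §2 eqs. (2)–(3)] -/
theorem exists_of_spectralSum_one_pos (hlam : ∀ i, 0 ≤ lam i)
    (hS : ∀ M, HasSum (fun i => lam i ^ M * q i) (S M)) (h : 0 < S 1) :
    ∃ j, q j ≠ 0 ∧ 0 < lam j := by
  by_contra hne
  push Not at hne
  have h0 : (fun i => lam i ^ 1 * q i) = fun _ => 0 := by
    funext i
    by_cases hi : q i = 0
    · simp [hi]
    · have : lam i = 0 := le_antisymm (hne i hi) (hlam i)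
      simp [this]
  have := hS 1
  rw [h0] at this
  exact (lt_irrefl _) ((this.unique hasSum_zero) ▸ h)

/-- In a non-degenerate channel every `S M` is positive. [cite: Michael1997, §2 eqs. (2)–(3)] -/
theorem spectralSum_pos (hlam : ∀ i, 0 ≤ lam i) (hq : ∀ i, 0 ≤ q i)
    (hS : ∀ M, HasSum (fun i => lam i ^ M * q i) (S M)) (h : ∃ j, q j ≠ 0 ∧ 0 < lam j) (M : ℕ) :
    0 < S M := by
  obtain ⟨j, hj, hjpos⟩ := h
  exact lt_of_lt_of_le (mul_pos (pow_pos hjpos M) (lt_of_le_of_ne (hq j) (Ne.symm hj)))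
    (mul_le_spectralSum hlam hq hS M j)

/-- In a non-degenerate channel `0 < Λ`. [cite: Michael1997, §2 eqs. (2)–(3)] -/
theorem spectralTop_pos (hL : ∀ i, lam i ≤ L) (h : ∃ j, q j ≠ 0 ∧ 0 < lam j) :
    0 < ⨆ i : {i // q i ≠ 0}, lam i := by
  obtain ⟨j, hj, hjpos⟩ := h
  exact lt_of_lt_of_le hjpos (le_spectralTop hL hj)

/-! ### Free energy per unit time: `log (S M) / M → log Λ` -/

/-- Lower comparison in a non-degenerate channel: `log λⱼ + (log qⱼ)/M ≤ log (S M)/M` for every level `j` with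
weight and every `M ≥ 1`. [folklore] -/
private theorem log_add_div_le (hlam : ∀ i, 0 ≤ lam i) (hq : ∀ i, 0 ≤ q i)
    (hS : ∀ M, HasSum (fun i => lam i ^ M * q i) (S M)) {j : ι} (hj : q j ≠ 0) (hjpos : 0 < lam j) {M : ℕ}
    (hM : 1 ≤ M) : Real.log (lam j) + Real.log (q j) / M ≤ Real.log (S M) / M := by
  have hMpos : (0 : ℝ) < M := by exact_mod_cast hM
  have hqj : 0 < q j := lt_of_le_of_ne (hq j) (Ne.symm hj)
  have hterm : 0 < lam j ^ M * q j := mul_pos (pow_pos hjpos M) hqj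
  have hle : Real.log (lam j ^ M * q j) ≤ Real.log (S M) :=
    Real.log_le_log hterm (mul_le_spectralSum hlam hq hS M j)
  rw [Real.log_mul (pow_pos hjpos M).ne' hqj.ne', Real.log_pow] at hle
  have : Real.log (lam j) + Real.log (q j) / M = (M * Real.log (lam j) + Real.log (q j)) / M := by
    field_simp
  rw [this]
  exact div_le_div_of_nonneg_right hle hMpos.le

/-- Upper comparison: `log (S M)/M ≤ log Λ + (log (S 0))/M` for `M ≥ 1` in a non-degenerate channel. [folklore] -/
private theorem log_div_le_add (hlam : ∀ i, 0 ≤ lam i) (hL : ∀ i, lam i ≤ L) (hq : ∀ i, 0 ≤ q i)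
    (hS : ∀ M, HasSum (fun i => lam i ^ M * q i) (S M)) (h : ∃ j, q j ≠ 0 ∧ 0 < lam j) {M : ℕ}
    (hM : 1 ≤ M) :
    Real.log (S M) / M ≤ Real.log (⨆ i : {i // q i ≠ 0}, lam i) + Real.log (S 0) / M := by
  have hMpos : (0 : ℝ) < M := by exact_mod_cast hM
  have hΛ := spectralTop_pos hL h
  have hS0 := spectralSum_pos hlam hq hS h 0
  have hle : Real.log (S M) ≤ Real.log ((⨆ i : {i // q i ≠ 0}, lam i) ^ M * S 0) :=
    Real.log_le_log (spectralSum_pos hlam hq hS h M) (spectralSum_le_spectralTop_pow_mul hlam hL hq hS M)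
  rw [Real.log_mul (pow_pos hΛ M).ne' hS0.ne', Real.log_pow] at hle
  have : Real.log (⨆ i : {i // q i ≠ 0}, lam i) + Real.log (S 0) / M =
      (M * Real.log (⨆ i : {i // q i ≠ 0}, lam i) + Real.log (S 0)) / M := by
    field_simp
  rw [this]
  exact div_le_div_of_nonneg_right hle hMpos.le

/-- ★ **Free energy per unit time converges to the energy of the lowest state in the channel**:
`log (S M) / M → log Λ` in every non-degenerate channel ('t Hooft: "in the limit `β → ∞`, `F` becomes the
energy of the lowest state with the given flux configuration"; Michael: "as `t → ∞`, the lightest glueball mass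
will dominate"). [cite: tHooft1979Flux, §5 after (5.4)] [cite: Michael1997, §2 eqs. (2)–(3)] -/
theorem tendsto_log_spectralSum_div (hlam : ∀ i, 0 ≤ lam i) (hL : ∀ i, lam i ≤ L) (hq : ∀ i, 0 ≤ q i)
    (hS : ∀ M, HasSum (fun i => lam i ^ M * q i) (S M)) (h : ∃ j, q j ≠ 0 ∧ 0 < lam j) :
    Tendsto (fun M : ℕ => Real.log (S M) / M) atTop (𝓝 (Real.log (⨆ i : {i // q i ≠ 0}, lam i))) := by
  have hΛ := spectralTop_pos hL h
  have hbdd : BddAbove (Set.range fun i : {i // q i ≠ 0} => lam i) :=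
    ⟨L, by rintro _ ⟨i, rfl⟩; exact hL i⟩
  haveI : Nonempty {i // q i ≠ 0} := by obtain ⟨j, hj, -⟩ := h; exact ⟨⟨j, hj⟩⟩
  rw [tendsto_order]
  refine ⟨fun a ha => ?_, fun a ha => ?_⟩
  · -- below the limit: pick a level `λⱼ > e^a` carrying weight
    have hexp : Real.exp a < ⨆ i : {i // q i ≠ 0}, lam i := (Real.lt_log_iff_exp_lt hΛ).1 ha
    obtain ⟨⟨j, hj⟩, hjgt⟩ := exists_lt_of_lt_ciSup hexp
    have hjpos : 0 < lam j := (Real.exp_pos a).trans hjgt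
    have hja : a < Real.log (lam j) := (Real.lt_log_iff_exp_lt hjpos).2 hjgt
    have hlim : Tendsto (fun M : ℕ => Real.log (lam j) + Real.log (q j) / M) atTop
        (𝓝 (Real.log (lam j))) := by
      have h1 := (tendsto_const_nhds (x := Real.log (lam j)) (f := (atTop : Filter ℕ))).add
        ((tendsto_const_nhds (x := Real.log (q j))).div_atTop (tendsto_natCast_atTop_atTop (R := ℝ)))
      simpa using h1
    filter_upwards [(tendsto_order.1 hlim).1 a hja, eventually_ge_atTop 1] with M hM hM1
    exact lt_of_lt_of_le hM (log_add_div_le hlam hq hS hj hjpos hM1)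
  · -- above the limit: `log (S M)/M ≤ log Λ + log (S 0)/M → log Λ`
    have hlim : Tendsto (fun M : ℕ => Real.log (⨆ i : {i // q i ≠ 0}, lam i) + Real.log (S 0) / M) atTop
        (𝓝 (Real.log (⨆ i : {i // q i ≠ 0}, lam i))) := by
      have h1 := (tendsto_const_nhds (x := Real.log (⨆ i : {i // q i ≠ 0}, lam i)) (f := (atTop : Filter ℕ))).add
        ((tendsto_const_nhds (x := Real.log (S 0))).div_atTop (tendsto_natCast_atTop_atTop (R := ℝ)))
      simpa using h1
    filter_upwards [(tendsto_order.1 hlim).2 a ha, eventually_ge_atTop 1] with M hM hM1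
    exact lt_of_le_of_lt (log_div_le_add hlam hL hq hS h hM1) hM

/-- ★ **Root test form**: `(S M)^{1/M} → Λ` in every non-degenerate channel. [cite: Michael1997, §2 eqs. (2)–(3)] -/
theorem tendsto_spectralSum_rpow_inv (hlam : ∀ i, 0 ≤ lam i) (hL : ∀ i, lam i ≤ L) (hq : ∀ i, 0 ≤ q i)
    (hS : ∀ M, HasSum (fun i => lam i ^ M * q i) (S M)) (h : ∃ j, q j ≠ 0 ∧ 0 < lam j) :
    Tendsto (fun M : ℕ => S M ^ (1 / (M : ℝ))) atTop (𝓝 (⨆ i : {i // q i ≠ 0}, lam i)) := by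
  have hΛ := spectralTop_pos hL h
  have hexp := (Real.continuous_exp.tendsto _).comp (tendsto_log_spectralSum_div hlam hL hq hS h)
  rw [Real.exp_log hΛ] at hexp
  refine hexp.congr fun M => ?_
  rw [Function.comp_apply, Real.rpow_def_of_pos (spectralSum_pos hlam hq hS h M), one_div, ← div_eq_mul_inv]

/-! ### Log-convexity and effective energies -/

/-- **Log-convexity** `S (M+1)² ≤ S M · S (M+2)` (Cauchy–Schwarz on the partial sums with the weights
`√(λᵢ^M qᵢ)` and `√(λᵢ^{M+2} qᵢ)`). [cite: MontvayMunster1994, §7.1 (7.29)–(7.31)] [cite: Michael1997, §2 eqs. (2)–(3)] -/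
theorem spectralSum_succ_sq_le (hlam : ∀ i, 0 ≤ lam i) (hq : ∀ i, 0 ≤ q i)
    (hS : ∀ M, HasSum (fun i => lam i ^ M * q i) (S M)) (M : ℕ) :
    S (M + 1) ^ 2 ≤ S M * S (M + 2) := by
  -- the finite Cauchy–Schwarz inequality on every partial sum
  have hfin : ∀ s : Finset ι, (∑ i ∈ s, lam i ^ (M + 1) * q i) ^ 2 ≤
      (∑ i ∈ s, lam i ^ M * q i) * (∑ i ∈ s, lam i ^ (M + 2) * q i) := by
    intro s
    have hcs := Finset.sum_mul_sq_le_sq_mul_sq s (fun i => Real.sqrt (lam i ^ M * q i))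
      (fun i => Real.sqrt (lam i ^ (M + 2) * q i))
    have h1 : ∀ i, Real.sqrt (lam i ^ M * q i) * Real.sqrt (lam i ^ (M + 2) * q i) = lam i ^ (M + 1) * q i := by
      intro i
      rw [← Real.sqrt_mul (mul_nonneg (pow_nonneg (hlam i) M) (hq i))]
      have : lam i ^ M * q i * (lam i ^ (M + 2) * q i) = (lam i ^ (M + 1) * q i) ^ 2 := by ring
      rw [this, Real.sqrt_sq (mul_nonneg (pow_nonneg (hlam i) _) (hq i))]
    have h2 : ∀ i, Real.sqrt (lam i ^ M * q i) ^ 2 = lam i ^ M * q i := fun i =>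
      Real.sq_sqrt (mul_nonneg (pow_nonneg (hlam i) M) (hq i))
    have h3 : ∀ i, Real.sqrt (lam i ^ (M + 2) * q i) ^ 2 = lam i ^ (M + 2) * q i := fun i =>
      Real.sq_sqrt (mul_nonneg (pow_nonneg (hlam i) _) (hq i))
    simp_rw [h1, h2, h3] at hcs
    exact hcs
  -- pass to the limit along `atTop : Filter (Finset ι)`
  exact le_of_tendsto_of_tendsto' ((hS (M + 1)).pow 2) (Filter.Tendsto.mul (hS M) (hS (M + 2))) hfin

/-- The ratios `S (M+1) / S M` are non-decreasing (non-degenerate channel). [cite: Michael1997, §2 eqs. (2)–(3)] -/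
theorem spectralSum_ratio_le_succ (hlam : ∀ i, 0 ≤ lam i) (hq : ∀ i, 0 ≤ q i)
    (hS : ∀ M, HasSum (fun i => lam i ^ M * q i) (S M)) (h : ∃ j, q j ≠ 0 ∧ 0 < lam j) (M : ℕ) :
    S (M + 1) / S M ≤ S (M + 2) / S (M + 1) := by
  have h0 := spectralSum_pos hlam hq hS h M
  have h1 := spectralSum_pos hlam hq hS h (M + 1)
  rw [div_le_div_iff₀ h0 h1]
  nlinarith [spectralSum_succ_sq_le hlam hq hS M]

/-- The ratios are bounded by the spectral top: `S (M+1) / S M ≤ Λ`; equivalently every EFFECTIVE ENERGY bounds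
the lowest energy in the channel from above: `−log Λ ≤ log (S M / S (M+1))` ("the effective mass is an upper
bound on the ground state mass"). [cite: Michael1997, §2 eqs. (2)–(3)] -/
theorem neg_log_spectralTop_le_effectiveEnergy (hlam : ∀ i, 0 ≤ lam i) (hL : ∀ i, lam i ≤ L) (hq : ∀ i, 0 ≤ q i)
    (hS : ∀ M, HasSum (fun i => lam i ^ M * q i) (S M)) (h : ∃ j, q j ≠ 0 ∧ 0 < lam j) (M : ℕ) :
    S (M + 1) / S M ≤ (⨆ i : {i // q i ≠ 0}, lam i) ∧
      -Real.log (⨆ i : {i // q i ≠ 0}, lam i) ≤ Real.log (S M / S (M + 1)) := by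
  have h0 := spectralSum_pos hlam hq hS h M
  have h1 := spectralSum_pos hlam hq hS h (M + 1)
  have hΛ := spectralTop_pos hL h
  have hr : S (M + 1) / S M ≤ ⨆ i : {i // q i ≠ 0}, lam i := by
    rw [div_le_iff₀ h0]
    exact spectralSum_succ_le hlam hL hq hS M
  refine ⟨hr, ?_⟩
  rw [← Real.log_inv]
  refine Real.log_le_log (inv_pos.2 hΛ) ?_
  rw [le_div_iff₀ h1]
  calc (⨆ i : {i // q i ≠ 0}, lam i)⁻¹ * S (M + 1) ≤ (⨆ i : {i // q i ≠ 0}, lam i)⁻¹ *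
      ((⨆ i : {i // q i ≠ 0}, lam i) * S M) :=
        mul_le_mul_of_nonneg_left (spectralSum_succ_le hlam hL hq hS M) (inv_pos.2 hΛ).le
    _ = S M := by rw [← mul_assoc, inv_mul_cancel₀ hΛ.ne', one_mul]

/-- The effective energies `log (S M / S (M+1))` are non-increasing in `M`
(Michael's "`m̂_eff(t) > m̂_eff(t+1)`", weakly). [cite: Michael1997, §2 eqs. (2)–(3)] -/
theorem effectiveEnergy_succ_le (hlam : ∀ i, 0 ≤ lam i) (hq : ∀ i, 0 ≤ q i)
    (hS : ∀ M, HasSum (fun i => lam i ^ M * q i) (S M)) (h : ∃ j, q j ≠ 0 ∧ 0 < lam j) (M : ℕ) :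
    Real.log (S (M + 1) / S (M + 2)) ≤ Real.log (S M / S (M + 1)) := by
  have h0 := spectralSum_pos hlam hq hS h M
  have h1 := spectralSum_pos hlam hq hS h (M + 1)
  have h2 := spectralSum_pos hlam hq hS h (M + 2)
  refine Real.log_le_log (div_pos h1 h2) ?_
  rw [div_le_div_iff₀ h2 h1]
  nlinarith [spectralSum_succ_sq_le hlam hq hS M]

/-- ★ **The ratios converge to the spectral top**: `S (M+1) / S M → Λ` (non-degenerate channel).  Proof: the ratios
increase and are `≤ Λ`, so they converge to their supremum `r ≤ Λ`; and `S M ≤ S 0 · r^M` forces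
`log Λ = lim log (S M)/M ≤ log r`. [cite: Michael1997, §2 eqs. (2)–(3)] [cite: MontvayMunster1994, §7.1 (7.29)–(7.31)] -/
theorem tendsto_spectralSum_ratio (hlam : ∀ i, 0 ≤ lam i) (hL : ∀ i, lam i ≤ L) (hq : ∀ i, 0 ≤ q i)
    (hS : ∀ M, HasSum (fun i => lam i ^ M * q i) (S M)) (h : ∃ j, q j ≠ 0 ∧ 0 < lam j) :
    Tendsto (fun M : ℕ => S (M + 1) / S M) atTop (𝓝 (⨆ i : {i // q i ≠ 0}, lam i)) := by
  set r : ℕ → ℝ := fun M => S (M + 1) / S M with hrdef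
  have hpos := spectralSum_pos hlam hq hS h
  have hΛ := spectralTop_pos hL h
  have hmono : Monotone r := monotone_nat_of_le_succ fun M => spectralSum_ratio_le_succ hlam hq hS h M
  have hrle : ∀ M, r M ≤ ⨆ i : {i // q i ≠ 0}, lam i := fun M =>
    (neg_log_spectralTop_le_effectiveEnergy hlam hL hq hS h M).1
  have hbdd : BddAbove (Set.range r) := ⟨_, by rintro _ ⟨M, rfl⟩; exact hrle M⟩
  have hconv : Tendsto r atTop (𝓝 (⨆ M, r M)) := tendsto_atTop_ciSup hmono hbdd
  -- the supremum of the ratios is the spectral top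
  have hrpos : ∀ M, 0 < r M := fun M => div_pos (hpos (M + 1)) (hpos M)
  have hsup_le : (⨆ M, r M) ≤ ⨆ i : {i // q i ≠ 0}, lam i := ciSup_le hrle
  have hsup_pos : 0 < ⨆ M, r M := lt_of_lt_of_le (hrpos 0) (le_ciSup hbdd 0)
  have hSle : ∀ M, S M ≤ S 0 * (⨆ M, r M) ^ M := by
    intro M
    induction M with
    | zero => simp
    | succ M ih =>
      have hstep : S (M + 1) = r M * S M := by
        simp only [hrdef]; rw [div_mul_cancel₀ _ (hpos M).ne']
      calc S (M + 1) = r M * S M := hstep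
        _ ≤ (⨆ M, r M) * (S 0 * (⨆ M, r M) ^ M) :=
            mul_le_mul (le_ciSup hbdd M) ih (hpos M).le hsup_pos.le
        _ = S 0 * (⨆ M, r M) ^ (M + 1) := by ring
  have hlog_le : Real.log (⨆ i : {i // q i ≠ 0}, lam i) ≤ Real.log (⨆ M, r M) := by
    have hlim := tendsto_log_spectralSum_div hlam hL hq hS h
    have hlim' : Tendsto (fun M : ℕ => Real.log (⨆ M, r M) + Real.log (S 0) / M) atTop
        (𝓝 (Real.log (⨆ M, r M))) := by
      have h1 := (tendsto_const_nhds (x := Real.log (⨆ M, r M)) (f := (atTop : Filter ℕ))).add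
        ((tendsto_const_nhds (x := Real.log (S 0))).div_atTop (tendsto_natCast_atTop_atTop (R := ℝ)))
      simpa using h1
    refine le_of_tendsto_of_tendsto hlim hlim' ?_
    filter_upwards [eventually_ge_atTop 1] with M hM
    have hMpos : (0 : ℝ) < M := by exact_mod_cast hM
    have hle : Real.log (S M) ≤ Real.log (S 0 * (⨆ M, r M) ^ M) := Real.log_le_log (hpos M) (hSle M)
    rw [Real.log_mul (hpos 0).ne' (pow_pos hsup_pos M).ne', Real.log_pow] at hle
    have : Real.log (⨆ M, r M) + Real.log (S 0) / M = (Real.log (S 0) + M * Real.log (⨆ M, r M)) / M := by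
      field_simp
      ring
    rw [this]
    exact div_le_div_of_nonneg_right hle hMpos.le
  have heq : (⨆ M, r M) = ⨆ i : {i // q i ≠ 0}, lam i :=
    le_antisymm hsup_le ((Real.log_le_log_iff hΛ hsup_pos).1 hlog_le)
  rwa [heq] at hconv

/-- ★ **Effective energies converge to the energy of the lowest state in the channel**:
`log (S M / S (M+1)) → −log Λ` — Michael's "`m̂₀ = lim_{t→∞} m̂_eff(t)`" for a positive spectral sum, with
`m̂₀ = −log Λ`. [cite: Michael1997, §2 eqs. (2)–(3)] [cite: MontvayMunster1994, §7.1 (7.29)–(7.31)] -/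
theorem tendsto_effectiveEnergy (hlam : ∀ i, 0 ≤ lam i) (hL : ∀ i, lam i ≤ L) (hq : ∀ i, 0 ≤ q i)
    (hS : ∀ M, HasSum (fun i => lam i ^ M * q i) (S M)) (h : ∃ j, q j ≠ 0 ∧ 0 < lam j) :
    Tendsto (fun M : ℕ => Real.log (S M / S (M + 1))) atTop (𝓝 (-Real.log (⨆ i : {i // q i ≠ 0}, lam i))) := by
  have hΛ := spectralTop_pos hL h
  have hpos := spectralSum_pos hlam hq hS h
  have hr := tendsto_spectralSum_ratio hlam hL hq hS h
  have hlog := ((Real.continuousAt_log hΛ.ne').tendsto.comp hr).neg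
  refine hlog.congr fun M => ?_
  rw [Function.comp_apply, ← Real.log_inv, inv_div]

end SpectralSum

end Literature.Analysis.OperatorTheory
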